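import Literature.Analysis.FluidPDE.AxisymPhiFourEnergy
import Literature.Analysis.FluidPDE.AxisymQuotientBounds
import Literature.Analysis.FluidPDE.AxisymPoloidalMoments
import Literature.Analysis.FluidPDE.AxisymOmegaThetaEnergy
import HarnessLib

/-!
# Weighted pointwise bounds for `Φ = u^θ/r`: `|xⱼΦ| ≤ |u|`, `|xⱼ∂ᵢΦ| ≤ 4|Du|`,
# `|Γ ∂ᵢ∂ᵢΦ| ≤ 20|Du|² + |u| |D∂ᵢu|`

Analysis/FluidPDE support file (calculus only; theorems, no definitions, no named facts) on the
way to `Literature.Analysis.FluidPDE.Wei2016_logModulus_regularity`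
(`LeiZhang2017AxisymmetricCriteria.lean`). The end of the proof of Wei 2016, Thm. 1.1 /
Lei–Zhang 2017, §3 (arXiv:1505.02628, p. 9: "we first derive an `L⁴` a priori estimate for
`v^θ` … then we use the equation of `ω^θ` …") integrates the equations of `v^θ` and `ω^θ`
against the weights `(v^θ)³` and `ω^θ`; in the smooth Hou–Li variable `Φ = angVelQuot u`
(`v^θ = rΦ`, `Γ = r²Φ`) these pairings carry the polynomial weights `r²`, `r⁴`, and their
absolute integrability rests on the following pointwise bounds, valid for every axisymmetric
field `u` (applied to `u = v` and to `u = ω = curl v`, `angVortQuot v = angVelQuot (curl v)`):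

* `IsAxisymmetric.abs_coord_mul_angVelQuot_le` — `|xⱼ Φ(x)| ≤ ‖u(x)‖` (`j = 0, 1`)
  (the tree's `IsAxisymmetric.cylRadius_mul_abs_angVelQuot_le`, `AxisymOmegaThetaEnergy`, gives `r|Φ| ≤ ‖u‖`);
* `IsAxisymmetric.abs_coord_mul_fderiv_angVelQuot_le` — `|xⱼ ∂ᵢΦ(x)| ≤ 4‖Du(x)‖`
  (differentiate `r²Φ = Γ`: `2xᵢΦ + r²∂ᵢΦ = ∂ᵢΓ = ⟪Jx, Du eᵢ⟫ + ⟪Jeᵢ, u⟫`, and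
  `|u_h| ≤ r‖Du‖`, `|Φ| ≤ ‖Du‖`);
* `IsAxisymmetric.abs_swirl_mul_fderiv_fderiv_angVelQuot_le` —
  `|Γ(x) ∂ᵢ∂ᵢΦ(x)| ≤ 20‖Du(x)‖² + ‖u(x)‖ ‖D(∂ᵢu)(x)‖` (differentiate once more:
  `r²∂ᵢ∂ᵢΦ = ∂ᵢ∂ᵢΓ − 2δΦ − 4xᵢ∂ᵢΦ`, `∂ᵢ∂ᵢΓ = 2⟪Jeᵢ, Du eᵢ⟫ + ⟪Jx, ∂ᵢ∂ᵢu⟫`, and `r|Φ| ≤ ‖u‖`).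

## References

* Z. Lei, Q. S. Zhang, arXiv:1505.02628, §3 p. 9 (the `L⁴` estimate of `v^θ` and the `L²`
  estimate of `ω^θ`). [LeiZhang2017]
* D. Wei, arXiv:1508.03318, end of the proof of Thm. 1.1. [Wei2016]
-/

noncomputable section

open Set Function InnerProductSpace
open scoped RealInnerProductSpace ContDiff

namespace Literature.Analysis.FluidPDE

namespace Wei2016

variable {u : EuclideanSpace ℝ (Fin 3) → EuclideanSpace ℝ (Fin 3)}

/-- `‖J v‖ ≤ ‖v‖` (`J v = (−v₁, v₀, 0)`). [folklore] -/
private theorem norm_rotGen_le_norm' (v : EuclideanSpace ℝ (Fin 3)) : ‖rotGen v‖ ≤ ‖v‖ := by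
  rw [norm_rotGen, EuclideanSpace.norm_eq]
  refine Real.sqrt_le_sqrt ?_
  simp only [Fin.sum_univ_three, Real.norm_eq_abs, sq_abs]
  nlinarith [sq_nonneg (v 2)]

/-- **`|xⱼ Φ(x)| ≤ ‖u(x)‖`** (`j = 0, 1`, `Φ = u^θ/r`; `r²Φ² = (u^θ)² ≤ |u|²`).
[cite: LeiZhang2017, §3 p. 9] -/
theorem _root_.Literature.Analysis.FluidPDE.IsAxisymmetric.abs_coord_mul_angVelQuot_le
    (hax : IsAxisymmetric u) (hu : ContDiff ℝ 2 u) {j : Fin 3} (hj : j = 0 ∨ j = 1)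
    (x : EuclideanSpace ℝ (Fin 3)) : |x j * angVelQuot u x| ≤ ‖u x‖ := by
  have h := hax.horizSq_mul_angVelQuot_sq_le hu x
  have hx : x j ^ 2 ≤ x 0 ^ 2 + x 1 ^ 2 := by
    rcases hj with rfl | rfl
    · nlinarith [sq_nonneg (x 1)]
    · nlinarith [sq_nonneg (x 0)]
  have hsq : (x j * angVelQuot u x) ^ 2 ≤ ‖u x‖ ^ 2 :=
    calc (x j * angVelQuot u x) ^ 2 = x j ^ 2 * angVelQuot u x ^ 2 := by ring
      _ ≤ (x 0 ^ 2 + x 1 ^ 2) * angVelQuot u x ^ 2 := mul_le_mul_of_nonneg_right hx (sq_nonneg _)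
      _ ≤ ‖u x‖ ^ 2 := h
  exact abs_le.2 (abs_le_of_sq_le_sq' hsq (norm_nonneg _))

/-- The derivative of `r²Φ` along `eᵢ`: `2(x₀(eᵢ)₀ + x₁(eᵢ)₁) Φ + r² ∂ᵢΦ = ∂ᵢΓ`. [folklore] -/
theorem _root_.Literature.Analysis.FluidPDE.IsAxisymmetric.fderiv_swirl_eq_add
    (hax : IsAxisymmetric u) (hu : ContDiff ℝ 3 u) (x h : EuclideanSpace ℝ (Fin 3)) :
    fderiv ℝ (swirl u) x h =
      2 * (x 0 * h 0 + x 1 * h 1) * angVelQuot u x + cylRadius x ^ 2 * fderiv ℝ (angVelQuot u) x h := by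
  have hu2 : ContDiff ℝ 2 u := hu.of_le (by norm_num)
  have hΦ1 : ContDiff ℝ 1 (angVelQuot u) := contDiff_angVelQuot (n := 1) (by exact_mod_cast hu)
  have hΦd : DifferentiableAt ℝ (angVelQuot u) x := (hΦ1.differentiable one_ne_zero) x
  have hfun : swirl u = fun y => (y 0 ^ 2 + y 1 ^ 2) * angVelQuot u y := by
    funext y
    rw [← cylRadius_sq, hax.cylRadius_sq_mul_angVelQuot hu2 y]
  rw [hfun, fderiv_fun_mul (hasFDerivAt_rho x).differentiableAt hΦd, cylRadius_sq]
  simp only [_root_.add_apply, _root_.smul_apply, smul_eq_mul, fderiv_rho_apply]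
  ring

/-- **`r |∂ₕΦ(x)| ≤ 4‖Du(x)‖`** for every direction `h` of norm `≤ 1` (`Φ = angVelQuot u`,
`u ∈ C³` axisymmetric; on the axis the left side vanishes). [cite: LeiZhang2017, §3 p. 9] -/
theorem _root_.Literature.Analysis.FluidPDE.IsAxisymmetric.cylRadius_mul_abs_fderiv_angVelQuot_le
    (hax : IsAxisymmetric u) (hu : ContDiff ℝ 3 u)
    {h : EuclideanSpace ℝ (Fin 3)} (hh : ‖h‖ ≤ 1) (y : EuclideanSpace ℝ (Fin 3)) :
    cylRadius y * |fderiv ℝ (angVelQuot u) y h| ≤ 4 * ‖fderiv ℝ u y‖ := by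
  have hu2 : ContDiff ℝ 2 u := hu.of_le (by norm_num)
  have hud : Differentiable ℝ u := hu.differentiable (by norm_num)
  by_cases hy : cylRadius y = 0
  · rw [hy, zero_mul]; positivity
  have hr : 0 < cylRadius y := lt_of_le_of_ne (cylRadius_nonneg y) (Ne.symm hy)
  -- `r² ∂ₕΦ = ∂ₕΓ − 2(y₀h₀ + y₁h₁)Φ`
  have hid := hax.fderiv_swirl_eq_add hu y h
  have hΓ' := fderiv_swirl_apply (hud y) h
  -- bounds of the pieces
  have b1 : |⟪rotGen y, fderiv ℝ u y h⟫| ≤ cylRadius y * ‖fderiv ℝ u y‖ := by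
    refine (abs_real_inner_le_norm _ _).trans ?_
    rw [norm_rotGen_eq_cylRadius']
    refine mul_le_mul_of_nonneg_left ?_ (cylRadius_nonneg y)
    calc ‖fderiv ℝ u y h‖ ≤ ‖fderiv ℝ u y‖ * ‖h‖ := ContinuousLinearMap.le_opNorm _ _
      _ ≤ ‖fderiv ℝ u y‖ * 1 := mul_le_mul_of_nonneg_left hh (norm_nonneg _)
      _ = ‖fderiv ℝ u y‖ := mul_one _
  have b2 : |⟪rotGen h, u y⟫| ≤ cylRadius y * ‖fderiv ℝ u y‖ := by
    rw [inner_rotGen_left]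
    have hh2 : h 0 ^ 2 + h 1 ^ 2 ≤ 1 := by
      have hn : ‖h‖ ^ 2 = h 0 ^ 2 + h 1 ^ 2 + h 2 ^ 2 := by
        rw [EuclideanSpace.norm_eq, Real.sq_sqrt (by positivity), Fin.sum_univ_three]
        simp only [Real.norm_eq_abs, sq_abs]
      nlinarith [sq_nonneg (h 2), pow_le_one₀ (norm_nonneg h) hh (n := 2)]
    have huh := hax.sqrt_sq_add_sq_le_mul_norm_fderiv (hud y)
    have hsq : (h 0 * u y 1 - h 1 * u y 0) ^ 2 ≤ (cylRadius y * ‖fderiv ℝ u y‖) ^ 2 := by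
      have h1 : (h 0 * u y 1 - h 1 * u y 0) ^ 2 ≤ (h 0 ^ 2 + h 1 ^ 2) * (u y 0 ^ 2 + u y 1 ^ 2) := by
        nlinarith [sq_nonneg (h 0 * u y 0 + h 1 * u y 1)]
      have h2 : u y 0 ^ 2 + u y 1 ^ 2 ≤ (cylRadius y * ‖fderiv ℝ u y‖) ^ 2 := by
        have := pow_le_pow_left₀ (Real.sqrt_nonneg _) huh 2
        rwa [Real.sq_sqrt (by positivity)] at this
      calc (h 0 * u y 1 - h 1 * u y 0) ^ 2 ≤ (h 0 ^ 2 + h 1 ^ 2) * (u y 0 ^ 2 + u y 1 ^ 2) := h1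
        _ ≤ 1 * (cylRadius y * ‖fderiv ℝ u y‖) ^ 2 :=
            mul_le_mul hh2 h2 (by positivity) zero_le_one
        _ = _ := one_mul _
    exact abs_le.2 (abs_le_of_sq_le_sq' hsq (by positivity))
  have b3 : |2 * (y 0 * h 0 + y 1 * h 1) * angVelQuot u y| ≤ 2 * (cylRadius y * ‖fderiv ℝ u y‖) := by
    have hyh : |y 0 * h 0 + y 1 * h 1| ≤ cylRadius y * 1 := by
      have := abs_horizontal_inner_le_cylRadius_mul y h
      exact this.trans (mul_le_mul_of_nonneg_left hh (cylRadius_nonneg y))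
    have hΦ := hax.abs_angVelQuot_le_norm_fderiv hu2 y
    rw [abs_mul, abs_mul, abs_two]
    calc 2 * |y 0 * h 0 + y 1 * h 1| * |angVelQuot u y| ≤ 2 * (cylRadius y * 1) * ‖fderiv ℝ u y‖ := by
          gcongr
      _ = 2 * (cylRadius y * ‖fderiv ℝ u y‖) := by ring
  -- `r² |∂ₕΦ| ≤ 4 r ‖Du‖`
  have hmain : cylRadius y ^ 2 * |fderiv ℝ (angVelQuot u) y h| ≤ 4 * (cylRadius y * ‖fderiv ℝ u y‖) := by
    have heq : cylRadius y ^ 2 * fderiv ℝ (angVelQuot u) y h =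
        ⟪rotGen y, fderiv ℝ u y h⟫ + ⟪rotGen h, u y⟫ - 2 * (y 0 * h 0 + y 1 * h 1) * angVelQuot u y := by
      linarith
    rw [← abs_of_pos (pow_pos hr 2), ← abs_mul, heq]
    calc |⟪rotGen y, fderiv ℝ u y h⟫ + ⟪rotGen h, u y⟫ - 2 * (y 0 * h 0 + y 1 * h 1) * angVelQuot u y|
        ≤ |⟪rotGen y, fderiv ℝ u y h⟫| + |⟪rotGen h, u y⟫| + |2 * (y 0 * h 0 + y 1 * h 1) * angVelQuot u y| :=
          (abs_sub _ _).trans (add_le_add (abs_add_le _ _) le_rfl)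
      _ ≤ 4 * (cylRadius y * ‖fderiv ℝ u y‖) := by linarith
  have h' : cylRadius y * (cylRadius y * |fderiv ℝ (angVelQuot u) y h|) ≤
      cylRadius y * (4 * ‖fderiv ℝ u y‖) := by
    rw [← mul_assoc, ← sq]
    exact hmain.trans_eq (by ring)
  exact le_of_mul_le_mul_left h' hr

/-- **`|xⱼ ∂ₕΦ(x)| ≤ 4‖Du(x)‖`** for `j = 0, 1` and every direction `h` of norm `≤ 1`
(`|xⱼ| ≤ r`). [cite: LeiZhang2017, §3 p. 9] -/
theorem _root_.Literature.Analysis.FluidPDE.IsAxisymmetric.abs_coord_mul_fderiv_angVelQuot_le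
    (hax : IsAxisymmetric u) (hu : ContDiff ℝ 3 u) {j : Fin 3} (hj : j = 0 ∨ j = 1)
    {h : EuclideanSpace ℝ (Fin 3)} (hh : ‖h‖ ≤ 1) (y : EuclideanSpace ℝ (Fin 3)) :
    |y j * fderiv ℝ (angVelQuot u) y h| ≤ 4 * ‖fderiv ℝ u y‖ := by
  have hyj : |y j| ≤ cylRadius y := by
    rw [cylRadius]
    refine Real.abs_le_sqrt ?_
    rcases hj with rfl | rfl
    · nlinarith [sq_nonneg (y 1)]
    · nlinarith [sq_nonneg (y 0)]
  rw [abs_mul]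
  calc |y j| * |fderiv ℝ (angVelQuot u) y h| ≤ cylRadius y * |fderiv ℝ (angVelQuot u) y h| :=
        mul_le_mul_of_nonneg_right hyj (abs_nonneg _)
    _ ≤ 4 * ‖fderiv ℝ u y‖ := hax.cylRadius_mul_abs_fderiv_angVelQuot_le hu hh y

/-- The second derivative of the swirl along a fixed direction:
`∂ₕ∂ₕΓ(x) = 2⟪J h, Du(x) h⟫ + ⟪J x, D(∂ₕu)(x) h⟫`. [folklore] -/
theorem fderiv_fderiv_swirl_apply (hu : ContDiff ℝ 2 u) (x h : EuclideanSpace ℝ (Fin 3)) :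
    fderiv ℝ (fun y => fderiv ℝ (swirl u) y h) x h =
      2 * ⟪rotGen h, fderiv ℝ u x h⟫ + ⟪rotGen x, fderiv ℝ (fun y => fderiv ℝ u y h) x h⟫ := by
  have hud : Differentiable ℝ u := hu.differentiable two_ne_zero
  have hDu : ContDiff ℝ 1 fun y => fderiv ℝ u y h :=
    (hu.fderiv_right (m := 1) (by norm_cast)).clm_apply contDiff_const
  have hDud : Differentiable ℝ fun y => fderiv ℝ u y h := hDu.differentiable one_ne_zero
  have hfun : (fun y => fderiv ℝ (swirl u) y h) = fun y => ⟪rotGen y, fderiv ℝ u y h⟫ + ⟪rotGen h, u y⟫ := by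
    funext y; exact fderiv_swirl_apply (hud y) h
  rw [hfun]
  have h1 : HasFDerivAt (fun y => ⟪rotGen y, fderiv ℝ u y h⟫)
      ((fderivInnerCLM ℝ (rotGen x, fderiv ℝ u x h)).comp (rotGenL.prod (fderiv ℝ (fun y => fderiv ℝ u y h) x))) x :=
    (hasFDerivAt_rotGen x).inner ℝ (hDud x).hasFDerivAt
  have h2 : HasFDerivAt (fun y => ⟪rotGen h, u y⟫)
      ((fderivInnerCLM ℝ (rotGen h, u x)).comp ((0 : EuclideanSpace ℝ (Fin 3) →L[ℝ] EuclideanSpace ℝ (Fin 3)).prod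
        (fderiv ℝ u x))) x :=
    (hasFDerivAt_const (rotGen h) x).inner ℝ (hud x).hasFDerivAt
  have h12 : HasFDerivAt (fun y => ⟪rotGen y, fderiv ℝ u y h⟫ + ⟪rotGen h, u y⟫)
      ((fderivInnerCLM ℝ (rotGen x, fderiv ℝ u x h)).comp (rotGenL.prod (fderiv ℝ (fun y => fderiv ℝ u y h) x)) +
        (fderivInnerCLM ℝ (rotGen h, u x)).comp ((0 : EuclideanSpace ℝ (Fin 3) →L[ℝ] EuclideanSpace ℝ (Fin 3)).prod
          (fderiv ℝ u x))) x := h1.add h2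
  rw [h12.fderiv]
  simp only [_root_.add_apply, ContinuousLinearMap.comp_apply, ContinuousLinearMap.prod_apply,
    fderivInnerCLM_apply, rotGenL_apply, _root_.zero_apply, inner_zero_left]
  rw [real_inner_comm (fderiv ℝ u x h) (rotGen h)]
  ring

/-- The second derivative of `r²Φ` along `eᵢ` (`i` fixed), in terms of `Φ`:
`∂ᵢ∂ᵢΓ = 2((eᵢ)₀² + (eᵢ)₁²) Φ + 4(x₀(eᵢ)₀ + x₁(eᵢ)₁) ∂ᵢΦ + r² ∂ᵢ∂ᵢΦ`. [folklore] -/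
theorem _root_.Literature.Analysis.FluidPDE.IsAxisymmetric.fderiv_fderiv_swirl_eq_add
    (hax : IsAxisymmetric u) (hu : ContDiff ℝ 4 u) (x h : EuclideanSpace ℝ (Fin 3)) :
    fderiv ℝ (fun y => fderiv ℝ (swirl u) y h) x h =
      2 * (h 0 * h 0 + h 1 * h 1) * angVelQuot u x +
        4 * (x 0 * h 0 + x 1 * h 1) * fderiv ℝ (angVelQuot u) x h +
        cylRadius x ^ 2 * fderiv ℝ (fun y => fderiv ℝ (angVelQuot u) y h) x h := by
  have hu3 : ContDiff ℝ 3 u := hu.of_le (by norm_num)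
  have hΦ2 : ContDiff ℝ 2 (angVelQuot u) := contDiff_angVelQuot (n := 2) (by exact_mod_cast hu)
  have hΦd : Differentiable ℝ (angVelQuot u) := hΦ2.differentiable two_ne_zero
  have hDΦ : ContDiff ℝ 1 fun y => fderiv ℝ (angVelQuot u) y h :=
    (hΦ2.fderiv_right (m := 1) (by norm_cast)).clm_apply contDiff_const
  have hDΦd : Differentiable ℝ fun y => fderiv ℝ (angVelQuot u) y h := hDΦ.differentiable one_ne_zero
  -- the first derivative as a function
  have hfun : (fun y => fderiv ℝ (swirl u) y h) = fun y =>
      (2 * (y 0 * h 0 + y 1 * h 1)) * angVelQuot u y + (y 0 ^ 2 + y 1 ^ 2) * fderiv ℝ (angVelQuot u) y h := by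
    funext y
    rw [hax.fderiv_swirl_eq_add hu3 y h, cylRadius_sq]
  rw [hfun]
  -- the linear factor `ℓ y = 2(y₀h₀ + y₁h₁)`
  set ℓ : EuclideanSpace ℝ (Fin 3) →L[ℝ] ℝ :=
    (2 * h 0) • (EuclideanSpace.proj (0 : Fin 3) : EuclideanSpace ℝ (Fin 3) →L[ℝ] ℝ) +
      (2 * h 1) • (EuclideanSpace.proj (1 : Fin 3) : EuclideanSpace ℝ (Fin 3) →L[ℝ] ℝ) with hℓ
  have hℓfun : (fun y : EuclideanSpace ℝ (Fin 3) => 2 * (y 0 * h 0 + y 1 * h 1)) = fun y => ℓ y := by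
    funext y
    simp only [hℓ, _root_.add_apply, _root_.smul_apply, smul_eq_mul, PiLp.proj_apply]
    ring
  have hℓd : ∀ y, HasFDerivAt (fun y : EuclideanSpace ℝ (Fin 3) => 2 * (y 0 * h 0 + y 1 * h 1)) ℓ y := by
    intro y; rw [hℓfun]; exact ℓ.hasFDerivAt
  have hA : HasFDerivAt (fun y => (2 * (y 0 * h 0 + y 1 * h 1)) * angVelQuot u y)
      ((2 * (x 0 * h 0 + x 1 * h 1)) • fderiv ℝ (angVelQuot u) x + angVelQuot u x • ℓ) x :=
    (hℓd x).mul (hΦd x).hasFDerivAt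
  have hB : HasFDerivAt (fun y : EuclideanSpace ℝ (Fin 3) => (y 0 ^ 2 + y 1 ^ 2) * fderiv ℝ (angVelQuot u) y h)
      ((x 0 ^ 2 + x 1 ^ 2) • fderiv ℝ (fun y => fderiv ℝ (angVelQuot u) y h) x +
        fderiv ℝ (angVelQuot u) x h •
          ((2 * x 0) • (EuclideanSpace.proj (0 : Fin 3) : EuclideanSpace ℝ (Fin 3) →L[ℝ] ℝ) +
            (2 * x 1) • (EuclideanSpace.proj (1 : Fin 3) : EuclideanSpace ℝ (Fin 3) →L[ℝ] ℝ))) x :=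
    (hasFDerivAt_rho x).mul (hDΦd x).hasFDerivAt
  have hAB : HasFDerivAt (fun y : EuclideanSpace ℝ (Fin 3) =>
      (2 * (y 0 * h 0 + y 1 * h 1)) * angVelQuot u y + (y 0 ^ 2 + y 1 ^ 2) * fderiv ℝ (angVelQuot u) y h)
      (((2 * (x 0 * h 0 + x 1 * h 1)) • fderiv ℝ (angVelQuot u) x + angVelQuot u x • ℓ) +
        ((x 0 ^ 2 + x 1 ^ 2) • fderiv ℝ (fun y => fderiv ℝ (angVelQuot u) y h) x +
          fderiv ℝ (angVelQuot u) x h •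
            ((2 * x 0) • (EuclideanSpace.proj (0 : Fin 3) : EuclideanSpace ℝ (Fin 3) →L[ℝ] ℝ) +
              (2 * x 1) • (EuclideanSpace.proj (1 : Fin 3) : EuclideanSpace ℝ (Fin 3) →L[ℝ] ℝ)))) x :=
    hA.add hB
  rw [hAB.fderiv, cylRadius_sq]
  simp only [_root_.add_apply, _root_.smul_apply, smul_eq_mul, PiLp.proj_apply, hℓ]
  ring

/-- **`|Γ(x) ∂ᵢ∂ᵢΦ(x)| ≤ 20‖Du(x)‖² + ‖u(x)‖ ‖D(∂ᵢu)(x)‖`** for every direction `eᵢ` of norm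
`≤ 1` (`Γ = swirl u = r²Φ`, `Φ = angVelQuot u`, `u ∈ C⁴` axisymmetric): on the axis `Γ = 0`;
off it `r²∂ᵢ∂ᵢΦ = ∂ᵢ∂ᵢΓ − 2|eᵢ,ₕ|²Φ − 4⟪x_h, eᵢ⟫∂ᵢΦ` with `|∂ᵢ∂ᵢΓ| ≤ 2‖Du‖ + r‖D(∂ᵢu)‖`,
`|Φ| ≤ ‖Du‖`, `r|∂ᵢΦ| ≤ 4‖Du‖`, and `r|Φ| ≤ ‖u‖`. [cite: LeiZhang2017, §3 p. 9] -/
theorem _root_.Literature.Analysis.FluidPDE.IsAxisymmetric.abs_swirl_mul_fderiv_fderiv_angVelQuot_le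
    (hax : IsAxisymmetric u) (hu : ContDiff ℝ 4 u)
    {h : EuclideanSpace ℝ (Fin 3)} (hh : ‖h‖ ≤ 1) (x : EuclideanSpace ℝ (Fin 3)) :
    |swirl u x * fderiv ℝ (fun y => fderiv ℝ (angVelQuot u) y h) x h| ≤
      20 * ‖fderiv ℝ u x‖ ^ 2 + ‖u x‖ * ‖fderiv ℝ (fun y => fderiv ℝ u y h) x‖ := by
  have hu2 : ContDiff ℝ 2 u := hu.of_le (by norm_num)
  have hu3 : ContDiff ℝ 3 u := hu.of_le (by norm_num)
  by_cases hx : cylRadius x = 0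
  · rw [swirl_eq_zero_of_cylRadius_eq_zero u hx, zero_mul, abs_zero]; positivity
  have hr : 0 < cylRadius x := lt_of_le_of_ne (cylRadius_nonneg x) (Ne.symm hx)
  -- the two expressions of `∂ₕ∂ₕΓ`
  have e1 := hax.fderiv_fderiv_swirl_eq_add hu x h
  have e2 := fderiv_fderiv_swirl_apply hu2 x h
  -- bounds
  have hh2 : h 0 * h 0 + h 1 * h 1 ≤ 1 := by
    have hn : ‖h‖ ^ 2 = h 0 ^ 2 + h 1 ^ 2 + h 2 ^ 2 := by
      rw [EuclideanSpace.norm_eq, Real.sq_sqrt (by positivity), Fin.sum_univ_three]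
      simp only [Real.norm_eq_abs, sq_abs]
    nlinarith [sq_nonneg (h 2), pow_le_one₀ (norm_nonneg h) hh (n := 2)]
  have hh0 : 0 ≤ h 0 * h 0 + h 1 * h 1 := by nlinarith [sq_nonneg (h 0), sq_nonneg (h 1)]
  have bΦ : |angVelQuot u x| ≤ ‖fderiv ℝ u x‖ := hax.abs_angVelQuot_le_norm_fderiv hu2 x
  have bDΦ : cylRadius x * |fderiv ℝ (angVelQuot u) x h| ≤ 4 * ‖fderiv ℝ u x‖ :=
    hax.cylRadius_mul_abs_fderiv_angVelQuot_le hu3 hh x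
  have bxh : |x 0 * h 0 + x 1 * h 1| ≤ cylRadius x :=
    (abs_horizontal_inner_le_cylRadius_mul x h).trans
      ((mul_le_mul_of_nonneg_left hh (cylRadius_nonneg x)).trans_eq (mul_one _))
  have bJh : ‖rotGen h‖ ≤ 1 := (norm_rotGen_le_norm' h).trans hh
  have bi1 : |⟪rotGen h, fderiv ℝ u x h⟫| ≤ ‖fderiv ℝ u x‖ := by
    refine (abs_real_inner_le_norm _ _).trans ?_
    calc ‖rotGen h‖ * ‖fderiv ℝ u x h‖ ≤ 1 * (‖fderiv ℝ u x‖ * ‖h‖) :=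
          mul_le_mul bJh (ContinuousLinearMap.le_opNorm _ _) (norm_nonneg _) zero_le_one
      _ ≤ 1 * (‖fderiv ℝ u x‖ * 1) := by gcongr
      _ = ‖fderiv ℝ u x‖ := by ring
  have bi2 : |⟪rotGen x, fderiv ℝ (fun y => fderiv ℝ u y h) x h⟫| ≤
      cylRadius x * ‖fderiv ℝ (fun y => fderiv ℝ u y h) x‖ := by
    refine (abs_real_inner_le_norm _ _).trans ?_
    rw [norm_rotGen_eq_cylRadius']
    refine mul_le_mul_of_nonneg_left ?_ (cylRadius_nonneg x)
    calc ‖fderiv ℝ (fun y => fderiv ℝ u y h) x h‖ ≤ ‖fderiv ℝ (fun y => fderiv ℝ u y h) x‖ * ‖h‖ :=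
          ContinuousLinearMap.le_opNorm _ _
      _ ≤ ‖fderiv ℝ (fun y => fderiv ℝ u y h) x‖ * 1 := by gcongr
      _ = _ := mul_one _
  -- `r² |∂ₕ∂ₕΦ| ≤ 20 ‖Du‖ + r ‖D(∂ₕu)‖`
  set M : ℝ := ‖fderiv ℝ u x‖ with hM
  set M₂ : ℝ := ‖fderiv ℝ (fun y => fderiv ℝ u y h) x‖ with hM₂
  have hM0 : 0 ≤ M := norm_nonneg _
  have hkey : cylRadius x ^ 2 * |fderiv ℝ (fun y => fderiv ℝ (angVelQuot u) y h) x h| ≤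
      20 * M + cylRadius x * M₂ := by
    have heq : cylRadius x ^ 2 * fderiv ℝ (fun y => fderiv ℝ (angVelQuot u) y h) x h =
        (2 * ⟪rotGen h, fderiv ℝ u x h⟫ + ⟪rotGen x, fderiv ℝ (fun y => fderiv ℝ u y h) x h⟫) -
          2 * (h 0 * h 0 + h 1 * h 1) * angVelQuot u x -
          4 * (x 0 * h 0 + x 1 * h 1) * fderiv ℝ (angVelQuot u) x h := by
      linarith
    rw [← abs_of_pos (pow_pos hr 2), ← abs_mul, heq]
    have t1 : |2 * ⟪rotGen h, fderiv ℝ u x h⟫ + ⟪rotGen x, fderiv ℝ (fun y => fderiv ℝ u y h) x h⟫| ≤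
        2 * M + cylRadius x * M₂ := by
      calc _ ≤ |2 * ⟪rotGen h, fderiv ℝ u x h⟫| + |⟪rotGen x, fderiv ℝ (fun y => fderiv ℝ u y h) x h⟫| :=
            abs_add_le _ _
        _ ≤ 2 * M + cylRadius x * M₂ := by rw [abs_mul, abs_two]; linarith
    have t2 : |2 * (h 0 * h 0 + h 1 * h 1) * angVelQuot u x| ≤ 2 * M := by
      rw [abs_mul, abs_mul, abs_two, abs_of_nonneg hh0]
      calc 2 * (h 0 * h 0 + h 1 * h 1) * |angVelQuot u x| ≤ 2 * 1 * M := by gcongr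
        _ = 2 * M := by ring
    have t3 : |4 * (x 0 * h 0 + x 1 * h 1) * fderiv ℝ (angVelQuot u) x h| ≤ 16 * M := by
      rw [abs_mul, abs_mul, show |(4 : ℝ)| = 4 by norm_num]
      calc 4 * |x 0 * h 0 + x 1 * h 1| * |fderiv ℝ (angVelQuot u) x h|
          ≤ 4 * cylRadius x * |fderiv ℝ (angVelQuot u) x h| := by gcongr
        _ = 4 * (cylRadius x * |fderiv ℝ (angVelQuot u) x h|) := by ring
        _ ≤ 4 * (4 * M) := by gcongr
        _ = 16 * M := by ring
    calc _ ≤ |2 * ⟪rotGen h, fderiv ℝ u x h⟫ + ⟪rotGen x, fderiv ℝ (fun y => fderiv ℝ u y h) x h⟫ -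
            2 * (h 0 * h 0 + h 1 * h 1) * angVelQuot u x| +
          |4 * (x 0 * h 0 + x 1 * h 1) * fderiv ℝ (angVelQuot u) x h| := abs_sub _ _
      _ ≤ (|2 * ⟪rotGen h, fderiv ℝ u x h⟫ + ⟪rotGen x, fderiv ℝ (fun y => fderiv ℝ u y h) x h⟫| +
          |2 * (h 0 * h 0 + h 1 * h 1) * angVelQuot u x|) +
          |4 * (x 0 * h 0 + x 1 * h 1) * fderiv ℝ (angVelQuot u) x h| := by
          gcongr; exact abs_sub _ _
      _ ≤ 20 * M + cylRadius x * M₂ := by linarith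
  -- `|Γ| = r² |Φ|`, `r|Φ| ≤ ‖u‖`
  have hΓ : swirl u x = cylRadius x ^ 2 * angVelQuot u x := (hax.cylRadius_sq_mul_angVelQuot hu2 x).symm
  have brΦ : cylRadius x * |angVelQuot u x| ≤ ‖u x‖ := hax.cylRadius_mul_abs_angVelQuot_le hu2 x
  rw [hΓ, abs_mul, abs_mul, abs_of_pos (pow_pos hr 2)]
  calc cylRadius x ^ 2 * |angVelQuot u x| * |fderiv ℝ (fun y => fderiv ℝ (angVelQuot u) y h) x h|
      = |angVelQuot u x| * (cylRadius x ^ 2 * |fderiv ℝ (fun y => fderiv ℝ (angVelQuot u) y h) x h|) := by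
        ring
    _ ≤ |angVelQuot u x| * (20 * M + cylRadius x * M₂) := mul_le_mul_of_nonneg_left hkey (abs_nonneg _)
    _ = 20 * (|angVelQuot u x| * M) + (cylRadius x * |angVelQuot u x|) * M₂ := by ring
    _ ≤ 20 * (M * M) + ‖u x‖ * M₂ := by
        gcongr
    _ = 20 * M ^ 2 + ‖u x‖ * M₂ := by ring

end Wei2016

end Literature.Analysis.FluidPDE

end
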